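/-
Copyright (c) 2026 the pub-hodgecm-mathlib formalisation cell (harness21).  Prover seat hodgecm-mathlib-K2E3-p21 (g6), Track B «K2-LIT» ∕ h413
(`stmt-HodgeConjecture-24833`), line `K2_E3_EllipticInputs`, line «SC′-IRR-lev» (lead K2E3-p24 (g2)), brick BLK (sequel); leaf (S-C′-irr)
`sig_K2E3GL3TwoBlockInducedIrreducible`.  2026-09-04.
-/
import Summits.HodgeConjecture.HodgeConjecture.Theorems.K2E3GL3CuspidalBlockRestriction   -- ★ BLK (this seat) p859461
import HarnessLib

/-!
# Crux `H413` — K2-LIT E3, line «SC′-IRR-lev», brick BLK (sequel): the Levi-irreducibility letter `hirr` in SUBGROUP currency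

Cell `hodgecm-mathlib`, Track B, line `K2_E3_EllipticInputs`; leaf (S-C′-irr).  BLK ★ `K2E3GL3CuspidalBlockRestriction` states `hirr` over `leviEmbeddingP F c₀ m` (JM-A's final
shape, lead 10:38:15Z) and over `⟨w₀ · blockDiagonalGL F ![0,1,1] m · w₀⁻¹, _⟩`.  JM-B `K2E3GL3CuspidalBlockJacquetCross` (K2E5-p17 (g6), 10:47:54Z) binds `hirr` in SUBGROUP
currency — `∀ (m : GL (Fin 3) F) (hm : m ∈ standardLeviGL F ![0,1,1]) y, y ∈ Y → σ′ ⟨w₀ * m * w₀⁻¹, _⟩ y ∈ Y` — so this sequel ships both letters in that currency too (the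
membership proof inside `⟨_, _⟩` is immaterial: proof irrelevance is definitional).  THEOREMS ONLY; count-neutral helper (`--supports stmt-HodgeConjecture-24833 --as helper`).

* **`forall_submodule_eq_bot_or_top_of_leviStable'`** — stable under `σ′ ⟨m, _⟩`, `m ∈ M = standardLeviGL F ![0,0,1]` ⇒ `Y = ⊥ ∨ Y = ⊤`.
* **`forall_submodule_eq_bot_or_top_of_leviStable_rev'`** — stable under `σ′ ⟨w₀ * m * w₀⁻¹, _⟩`, `m ∈ M′ = standardLeviGL F ![0,1,1]` ⇒ `Y = ⊥ ∨ Y = ⊤` (JM-B's binder).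

HONEST LABEL: HC_CM is proved only modulo the 7 printed citations (2 remaining named inputs: hLiu418 = stmt-HodgeConjecture-24832, h413 =
stmt-HodgeConjecture-24833) until rung 0 closes; elementary; closes no organ by itself.

## References
* [BernsteinZelevinsky1976] I. N. Bernstein, A. V. Zelevinsky, Russian Math. Surveys 31:3 (1976), §2.10–2.11 (Schur's lemma, irreducibility).
* [BernsteinZelevinsky1977] I. N. Bernstein, A. V. Zelevinsky, Ann. Sci. ÉNS 10 (1977), §2.1 (parabolic data `(P, M, U)`).
-/

set_option autoImplicit false
-- the mandated namespace repeats `HodgeConjecture.HodgeConjecture`, as in every `Theorems/*.lean` of this sub-problem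
set_option linter.dupNamespace false

noncomputable section

open Literature.NumberTheory.Automorphic Representation
open Summit.HodgeConjecture.HodgeConjecture.Cruxes.H413

namespace Summit.HodgeConjecture.HodgeConjecture.Cruxes.H413.K2E3GL3CuspidalBlockRestriction

variable (F : Type*) [Field F] [ValuativeRel F] [TopologicalSpace F] [IsNonarchimedeanLocalField F]

/-- **`hirr` in subgroup currency (JM-A side)**: a submodule `Y ≤ W` stable under `σ′ ⟨m, _⟩` for all `m ∈ M = standardLeviGL F ![0,0,1]` is `⊥` or `⊤`
(`leviEmbeddingP F c₀ m = ⟨blockDiagonalGL F c₀ m, _⟩` with `blockDiagonalGL F c₀ m ∈ M`; then ★ `forall_submodule_eq_bot_or_top_of_leviStable`).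
[cite: BernsteinZelevinsky1976, §2.10] [cite: BernsteinZelevinsky1977, §2.1] -/
theorem forall_submodule_eq_bot_or_top_of_leviStable' {W : Type*} [AddCommGroup W] [Module ℂ W]
    (σ : Representation ℂ (Π a, GL {i // (![0, 0, 1] : Fin 3 → Fin 2) i = a} F) W) [σ.IsIrreducible] (Y : Submodule ℂ W)
    (hY : ∀ (m : GL (Fin 3) F) (hm : m ∈ standardLeviGL F (![0, 0, 1] : Fin 3 → Fin 2)) (y : W), y ∈ Y →
      Representation.twist (σ.comp (leviProjection F (![0, 0, 1] : Fin 3 → Fin 2))) (rootDeltaChar (standardParabolicGL F (![0, 0, 1] : Fin 3 → Fin 2)))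
        ⟨m, standardLeviGL_le _ _ hm⟩ y ∈ Y) :
    Y = ⊥ ∨ Y = ⊤ :=
  forall_submodule_eq_bot_or_top_of_leviStable F σ Y fun m y hy => hY (blockDiagonalGL F (![0, 0, 1] : Fin 3 → Fin 2) m) ⟨m, rfl⟩ y hy

/-- **`hirr` in subgroup currency (JM-B's binder)**: a submodule `Y ≤ W` stable under `σ′ ⟨w₀ * m * w₀⁻¹, _⟩` for all `m ∈ M′ = standardLeviGL F ![0,1,1]`, `w₀ = permGL Fin.revPerm`,
is `⊥` or `⊤` (★ `forall_submodule_eq_bot_or_top_of_leviStable_rev` at `m := blockDiagonalGL F ![0,1,1] m`). [cite: BernsteinZelevinsky1976, §2.10] [cite: BernsteinZelevinsky1977, §2.1] -/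
theorem forall_submodule_eq_bot_or_top_of_leviStable_rev' {W : Type*} [AddCommGroup W] [Module ℂ W]
    (σ : Representation ℂ (Π a, GL {i // (![0, 0, 1] : Fin 3 → Fin 2) i = a} F) W) [σ.IsIrreducible] (Y : Submodule ℂ W)
    (hY : ∀ (m : GL (Fin 3) F) (hm : m ∈ standardLeviGL F (![0, 1, 1] : Fin 3 → Fin 2)) (y : W), y ∈ Y →
      Representation.twist (σ.comp (leviProjection F (![0, 0, 1] : Fin 3 → Fin 2))) (rootDeltaChar (standardParabolicGL F (![0, 0, 1] : Fin 3 → Fin 2)))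
        ⟨(permGL Fin.revPerm : GL (Fin 3) F) * m * (permGL Fin.revPerm)⁻¹, standardLeviGL_le _ _ (permGL_rev_conj_mem_standardLeviGL_twoOne F hm)⟩ y ∈ Y) :
    Y = ⊥ ∨ Y = ⊤ :=
  forall_submodule_eq_bot_or_top_of_leviStable_rev F σ Y fun m y hy => hY (blockDiagonalGL F (![0, 1, 1] : Fin 3 → Fin 2) m) ⟨m, rfl⟩ y hy

/-- **`hirr` from plain `σ`-language**: conversely to the above, if `Y` is stable under `σ l` for all `l : Π_a GL {i ∕∕ c₀ i = a} F` then it is stable under `σ′ ⟨m, _⟩`, `m ∈ M`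
(`σ′ ⟨m,_⟩ y = δ^{1∕2}(m) • σ (proj m) y`), hence `⊥` or `⊤`; recorded so that ASM may feed either currency. [cite: BernsteinZelevinsky1976, §2.10] -/
theorem forall_submodule_eq_bot_or_top_of_stable {W : Type*} [AddCommGroup W] [Module ℂ W]
    (σ : Representation ℂ (Π a, GL {i // (![0, 0, 1] : Fin 3 → Fin 2) i = a} F) W) [σ.IsIrreducible] (Y : Submodule ℂ W)
    (hY : ∀ (l : Π a, GL {i // (![0, 0, 1] : Fin 3 → Fin 2) i = a} F) (y : W), y ∈ Y → σ l y ∈ Y) : Y = ⊥ ∨ Y = ⊤ := by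
  refine forall_submodule_eq_bot_or_top_of_leviStable F σ Y fun m y hy => ?_
  rw [Representation.twist_apply, MonoidHom.comp_apply]
  exact Y.smul_mem _ (hY _ y hy)

end Summit.HodgeConjecture.HodgeConjecture.Cruxes.H413.K2E3GL3CuspidalBlockRestriction

end
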